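import Mathlib.Probability.Moments.ComplexMGF
import Literature.Probability.LatticeModels.CumulantsAnalytic
import HarnessLib

/-!
# Stub `stub_cumulantTaylorBridge` of the crux line `tilt-analyticity-transfer`
(crux `AntiMazurCoboundaries.CellForecastPressureDecay`, stmt-AtomisticToContinuum-13915)

Helper file of the line (`--supports stmt-AtomisticToContinuum-13915`): cumulants are the Taylor
coefficients at `0` of ANY local holomorphic logarithm of the moment generating function of a bounded
real random variable (tree `Literature.Probability.LatticeModels.iteratedDeriv_succ_eq_cumulantOf` +
Mathlib `ProbabilityTheory.complexMGF`).
-/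

noncomputable section

open MeasureTheory Set Metric Filter ProbabilityTheory Topology
open scoped ENNReal BigOperators
-- (the line's objects module is not needed by this pure-analysis stub and is not imported, so its
-- ambient `open Literature.Analysis.FluidPDE Literature.MathematicalPhysics.KineticTheory` is omitted)
open Literature.Probability.LatticeModels (cumulantOf)

namespace Summit.AtomisticToContinuum.HydrodynamicLimit.Theorems.TiltAnalyticity

section CumulantTaylorBridge

variable {Ω : Type*} [MeasurableSpace Ω]

/-- For a bounded measurable real variable on a finite measure space, `e^{tX}` is integrable for
every real `t`: `integrableExpSet X P = univ`. -/
private theorem integrableExpSet_eq_univ_of_bdd (P : Measure Ω) [IsFiniteMeasure P]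
    {X : Ω → ℝ} {C : ℝ} (hX : Measurable X) (hb : ∀ ω, |X ω| ≤ C) :
    integrableExpSet X P = Set.univ := by
  -- adapted from `integrableExpSet_eq_univ_of_abs_le` (LabelCumulantDifferentiable, private)
  refine Set.eq_univ_of_forall fun t => ?_
  change Integrable (fun ω => Real.exp (t * X ω)) P
  refine Integrable.of_bound (hX.const_mul t).exp.aestronglyMeasurable (Real.exp (|t| * C))
    (Eventually.of_forall fun ω => ?_)
  rw [Real.norm_eq_abs, Real.abs_exp, Real.exp_le_exp]
  calc t * X ω ≤ |t * X ω| := le_abs_self _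
    _ = |t| * |X ω| := abs_mul _ _
    _ ≤ |t| * C := mul_le_mul_of_nonneg_left (hb ω) (abs_nonneg t)

/-- For a bounded measurable real variable on a finite measure space, every complex `z` lies in the
strip of holomorphy of `complexMGF X P`. -/
private theorem re_mem_interior_integrableExpSet_of_bdd (P : Measure Ω) [IsFiniteMeasure P]
    {X : Ω → ℝ} {C : ℝ} (hX : Measurable X) (hb : ∀ ω, |X ω| ≤ C) (z : ℂ) :
    z.re ∈ interior (integrableExpSet X P) := by
  rw [integrableExpSet_eq_univ_of_bdd P hX hb, interior_univ]
  trivial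

/-- The moments of a bounded measurable real variable are the derivatives at `0` of its complex
moment generating function: `(complexMGF X P)^{(m)}(0) = E[X^m]`. -/
private theorem iteratedDeriv_complexMGF_zero_of_bdd (P : Measure Ω) [IsFiniteMeasure P]
    {X : Ω → ℝ} {C : ℝ} (hX : Measurable X) (hb : ∀ ω, |X ω| ≤ C) (m : ℕ) :
    iteratedDeriv m (complexMGF X P) 0 = ∫ ω, ((X ω : ℝ) : ℂ) ^ m ∂P := by
  rw [iteratedDeriv_complexMGF (re_mem_interior_integrableExpSet_of_bdd P hX hb 0) m]
  refine integral_congr_ae (Eventually.of_forall fun ω => ?_)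
  simp

end CumulantTaylorBridge

/-- **Registered stub S3a `stub_cumulantTaylorBridge`** (line `tilt-analyticity-transfer`, crux
stmt-AtomisticToContinuum-13915): for a bounded measurable real variable `Y` on a probability space and
any `F` holomorphic on a disc about `0` with `F 0 = 0` and `exp (F c) = E e^{cY}` there,
`F^{(k+1)}(0) = κ_{k+1}`, the `(k+1)`-st cumulant of the moment sequence `m ↦ E[Y^m]`
(Camia–Jiang–Newman 2023 (1)⟺(2); Ruelle 1969 §4.4.1). [folklore] -/
theorem stub_cumulantTaylorBridge :
    ∀ (Ω : Type) [MeasurableSpace Ω] (P : Measure Ω) [IsProbabilityMeasure P] (Y : Ω → ℝ) (A : ℝ),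
      Measurable Y → (∀ ω, |Y ω| ≤ A) →
      ∀ r : ℝ, 0 < r → ∀ F : ℂ → ℂ, DifferentiableOn ℂ F (ball 0 r) → F 0 = 0 →
        (∀ c : ℂ, ‖c‖ < r → Complex.exp (F c) = ∫ ω, Complex.exp (c * (Y ω : ℂ)) ∂P) →
        ∀ k : ℕ, iteratedDeriv (k + 1) F 0 =
          cumulantOf (fun m => ∫ ω, ((Y ω : ℝ) : ℂ) ^ m ∂P) (k + 1) := by
  intro Ω _ P _ Y A hY hb r hr F hF _hF0 hexp k
  -- the complex moment generating function `f = complexMGF Y P` is entire, `f 0 = 1`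
  have hf : AnalyticAt ℂ (complexMGF Y P) 0 :=
    analyticAt_complexMGF (re_mem_interior_integrableExpSet_of_bdd P hY hb 0)
  have hL : AnalyticAt ℂ F 0 := hF.analyticAt (isOpen_ball.mem_nhds (mem_ball_self hr))
  have hfL : ∀ᶠ z in 𝓝 (0 : ℂ), complexMGF Y P z = Complex.exp (F z) := by
    filter_upwards [ball_mem_nhds (0 : ℂ) hr] with c hc
    rw [hexp c (mem_ball_zero_iff.1 hc)]
    rfl
  have hf0 : complexMGF Y P 0 = 1 := by
    simp [complexMGF]
  have hmom : (fun m => iteratedDeriv m (complexMGF Y P) 0) =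
      fun m => ∫ ω, ((Y ω : ℝ) : ℂ) ^ m ∂P :=
    funext fun m => iteratedDeriv_complexMGF_zero_of_bdd P hY hb m
  rw [Literature.Probability.LatticeModels.iteratedDeriv_succ_eq_cumulantOf hf hL hfL hf0 k, hmom]

end Summit.AtomisticToContinuum.HydrodynamicLimit.Theorems.TiltAnalyticity

end
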